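import Mathlib
import Summits.Ventures.PercRepro2.Defs
import Summits.Ventures.PercRepro2.Graph
import Summits.Ventures.PercRepro2.OneColourSwitch
import Summits.Ventures.PercRepro2.RegionHubSign
import Summits.Ventures.PercRepro2.SideSwitch
import Summits.Ventures.PercRepro2.TermSwitchDefs
import Summits.Ventures.PercRepro2.TermSwitchReach
import Summits.Ventures.PercRepro2.M9NoPocketDefs
import Summits.Ventures.PercRepro2.M9GeneralDSplit
import Summits.Ventures.PercRepro2.M9LinkedHD
import Summits.Ventures.PercRepro2.M9HDRSplit
import Summits.Ventures.PercRepro2.M9WorldSwitch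

/-!
# The `W`-world switch sends `W`-only hub–dead-end colourings to `Y`-only ones with a smaller
`σ_pq` (blind cell PercRepro2, p3 g30, 2026-08-28; `proofs/P3-HDR.md` §4, THEOREM ψ)

Continuation of `M9WorldSwitch`: on a `K`-side hub–dead-end colouring the switch of a closed
subset `S` of the `W`-world keeps the hub / dead end (`HD_flipTouch`: the `W`-cluster of `d` only
grows), does not increase `σ_pq` (`sigma_flipTouch_le`: `Y`-paths of the image between `p` and
`q` avoid `S`, `W`-paths of the source avoid `S`), produces `r ~_Y s` when the `W`-edges touching
`S` join `r` to `s` (`conn_rs_flipTouch_of_wIn`) and `r ≁_W s` when no `W`-path avoiding `S` does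
(`not_conn_compl_rs_flipTouch_of_wOut`).  Together (`hdKYOnly_flipTouch_of_wOnly`): every `W`-only
`K`-side hub–dead-end colouring is sent to a `Y`-only one with `σ_pq` not larger — the pointwise
content of the switch `ψ` of `proofs/P3-HDR.md` §4 (with `S` = the linking components of the
`W`-world).  Own work; std axioms.
-/

namespace Summit.Ventures.PercRepro2

namespace NoPocket

open Finset Classical RegionHub OneColourSwitch SideSwitch TermSwitch

variable {V : Type*} {E : Type*}

section SwitchHD

variable {ends : E → Sym2 V} {p q r s d : V} {ω : Config E} {S : Set V}

/-- On a `K`-side hub–dead-end colouring `d ∉ M₂`. -/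
lemma not_mem_M2_of_HD_K (h : HD ends p q r s d ω) (hK : d ∈ K2 ends r s ω) :
    d ∉ M2 ends r s ω := by
  obtain ⟨_, _, hone, -⟩ := hd_iff_dzero.1 h
  rcases hone with ⟨_, hM⟩ | ⟨_, hK'⟩
  · exact hM
  · exact absurd hK hK'

/-- **The hub–dead-end property survives the switch** (on the `K`-side). -/
theorem HD_flipTouch (h : HD ends p q r s d ω) (hK : d ∈ K2 ends r s ω)
    (hS : WClosed ends r s ω S) : HD ends p q r s d (flipTouch ends S ω) := by
  have hM : d ∉ M2 ends r s ω := not_mem_M2_of_HD_K h hK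
  have hsep : sep2 ends p q r s ω := h.1
  have hD : DOne ends r s d ω := h.2.1
  refine ⟨sep2_flipTouch hsep hD hM hS, DOne_flipTouch hD hM hS,
    Or.inl (mem_K2_flipTouch_of_mem hD hM hS hK), ?_⟩
  rintro ⟨hsepH, hDZ⟩
  rcases hub_or_dead_of_HD_K h hK with hp | hq | ⟨x, hxr, hxs, hxd, hxK, hxc⟩
  · exact hsepH.2.2.1 (mem_MH_triple'.2 (Or.inr (conn_compl_d_flipTouch hM hS hp)))
  · exact hsepH.2.2.2 (mem_MH_triple'.2 (Or.inr (conn_compl_d_flipTouch hM hS hq)))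
  · have hxH : x ∉ ({r, s, d} : Set V) := by
      simp only [Set.mem_insert_iff, Set.mem_singleton_iff, not_or]
      exact ⟨hxr, hxs, hxd⟩
    have hxK' : x ∈ KH ends ({r, s, d} : Set V) (flipTouch ends S ω) :=
      mem_KH_triple'.2 (Or.inl (by rw [K2_flipTouch hD hM hS]; exact Or.inl hxK))
    exact hDZ x hxH hxK' (mem_MH_triple'.2 (Or.inr (conn_compl_d_flipTouch hM hS hxc)))

/-- A `Y`-connection `p ~ q` of the switched colouring is one of the source: it avoids `S`. -/
lemma conn_pq_of_conn_pq_flipTouch (hsep : sep2 ends p q r s ω) (hD : DOne ends r s d ω)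
    (hM : d ∉ M2 ends r s ω) (hS : WClosed ends r s ω S)
    (hc : Conn ends (flipTouch ends S ω) p q) : Conn ends ω p q := by
  obtain ⟨hpK, _⟩ := not_mem_K2_of_sep2 hsep
  obtain ⟨hpM, _⟩ := not_mem_M2_of_sep2 hsep
  have key : ∀ v, v ∈ {y | Conn ends ω p y ∧ y ∉ S} → ∀ y,
      (openGraph ends (flipTouch ends S ω)).Adj v y → y ∈ {y | Conn ends ω p y ∧ y ∉ S} := by
    intro v ⟨hv, hvS⟩ y hvy
    obtain ⟨_, e, he, hends⟩ := openGraph_adj.1 hvy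
    have ht : e ∉ touches ends S := by
      intro ht
      rw [flipTouch_of_mem ends ht] at he
      have hw : ω e = false := by
        rcases h : ω e with _ | _
        · rfl
        · rw [h] at he; exact absurd he (by decide)
      obtain ⟨z, hz, w, hzw⟩ := ht
      have hyS : y ∈ S := by
        rw [hends, Sym2.eq_iff] at hzw
        rcases hzw with ⟨rfl, _⟩ | ⟨_, rfl⟩
        · exact absurd hz hvS
        · exact hz
      have hvM : v ∈ M2 ends r s ω :=
        mem_M2_of_closed (hS.subset y hyS).1 hw (by rw [hends, Sym2.eq_swap])
      by_cases hvr : v = r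
      · subst hvr; exact hpK (mem_K2_iff.2 (Or.inl (conn_symm hv)))
      by_cases hvs : v = s
      · subst hvs; exact hpK (mem_K2_iff.2 (Or.inr (conn_symm hv)))
      exact hvS (hS.closed e y v (by rw [hends, Sym2.eq_swap]) hyS hvM hvr hvs)
    rw [flipTouch_of_notMem ends ht] at he
    exact ⟨conn_trans hv (conn_of_openAdj ⟨e, he, hends⟩),
      fun hyS => ht (mem_touches_of_ends hends (Or.inr hyS))⟩
  exact (mem_of_conn_of_closed key ⟨conn_refl _ _ _, fun h => hpM (hS.subset p h).1⟩ hc).1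

/-- A `W`-connection `p ~ q` of the source survives the switch: it avoids `S`. -/
lemma conn_compl_pq_flipTouch_of_conn (hsep : sep2 ends p q r s ω) (hS : WClosed ends r s ω S)
    (hc : Conn ends (OneColourSwitch.compl ω) p q) :
    Conn ends (OneColourSwitch.compl (flipTouch ends S ω)) p q := by
  obtain ⟨hpM, _⟩ := not_mem_M2_of_sep2 hsep
  have key : ∀ v, v ∈ {y | Conn ends (OneColourSwitch.compl (flipTouch ends S ω)) p y ∧ y ∉ S ∧
      Conn ends (OneColourSwitch.compl ω) p y} → ∀ y,
      (openGraph ends (OneColourSwitch.compl ω)).Adj v y →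
        y ∈ {y | Conn ends (OneColourSwitch.compl (flipTouch ends S ω)) p y ∧ y ∉ S ∧
          Conn ends (OneColourSwitch.compl ω) p y} := by
    intro v ⟨hv', hvS, hvp⟩ y hvy
    obtain ⟨_, e, he, hends⟩ := openGraph_adj.1 hvy
    have hw : ω e = false := by
      simp only [OneColourSwitch.compl, Bool.not_eq_true'] at he
      exact he
    have hyp : Conn ends (OneColourSwitch.compl ω) p y :=
      conn_trans hvp (conn_of_openAdj ⟨e, he, hends⟩)
    have hyS : y ∉ S := by
      intro hyS
      have hvM : v ∈ M2 ends r s ω :=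
        mem_M2_of_closed (hS.subset y hyS).1 hw (by rw [hends, Sym2.eq_swap])
      apply hpM
      rcases mem_M2_iff.1 hvM with h | h
      · exact mem_M2_iff.2 (Or.inl (conn_trans h (conn_symm hvp)))
      · exact mem_M2_iff.2 (Or.inr (conn_trans h (conn_symm hvp)))
    have ht : e ∉ touches ends S := by
      rintro ⟨z, hz, w, hzw⟩
      rw [hends, Sym2.eq_iff] at hzw
      rcases hzw with ⟨rfl, _⟩ | ⟨_, rfl⟩
      · exact hvS hz
      · exact hyS hz
    have he' : OneColourSwitch.compl (flipTouch ends S ω) e = true := by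
      simp only [OneColourSwitch.compl, flipTouch_of_notMem ends ht, hw]
      rfl
    exact ⟨conn_trans hv' (conn_of_openAdj ⟨e, he', hends⟩), hyS, hyp⟩
  exact (mem_of_conn_of_closed key ⟨conn_refl _ _ _, fun h => hpM (hS.subset p h).1,
    conn_refl _ _ _⟩ hc).1

/-- **The colour preference of `p, q` does not increase under the switch.** -/
theorem sigma_flipTouch_le (hsep : sep2 ends p q r s ω) (hD : DOne ends r s d ω)
    (hM : d ∉ M2 ends r s ω) (hS : WClosed ends r s ω S) :
    sigma ends (flipTouch ends S ω) p q ≤ sigma ends ω p q := by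
  simp only [sigma]
  have h1 := conn_pq_of_conn_pq_flipTouch hsep hD hM hS (S := S)
  have h2 := conn_compl_pq_flipTouch_of_conn hsep hS (S := S)
  by_cases hY : Conn ends (flipTouch ends S ω) p q <;>
    by_cases hW : Conn ends (OneColourSwitch.compl ω) p q
  · rw [if_pos hY, if_pos (h1 hY), if_pos hW, if_pos (h2 hW)]
  · rw [if_pos hY, if_pos (h1 hY), if_neg hW]
    split_ifs <;> norm_num
  · rw [if_neg hY, if_pos hW, if_pos (h2 hW)]
    split_ifs <;> norm_num
  · rw [if_neg hY, if_neg hW]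
    split_ifs <;> norm_num

/-- The `W`-edges touching `S` are `Y`-edges of the switched colouring. -/
lemma wIn_le_flipTouch : wIn ends S ω ≤ flipTouch ends S ω := by
  intro e
  simp only [wIn]
  by_cases ht : e ∈ touches ends S
  · rw [if_pos ht, flipTouch_of_mem ends ht]
  · rw [if_neg ht]
    exact Bool.false_le _

/-- **`r ~_Y s` after the switch** when the `W`-edges touching `S` join `r` to `s`. -/
theorem conn_rs_flipTouch_of_wIn (h : Conn ends (wIn ends S ω) r s) :
    Conn ends (flipTouch ends S ω) r s :=
  conn_mono wIn_le_flipTouch h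

/-- **`r ≁_W s` after the switch** when no `W`-path avoiding `S` joins `r` to `s`. -/
theorem not_conn_compl_rs_flipTouch_of_wOut (hD : DOne ends r s d ω) (hM : d ∉ M2 ends r s ω)
    (hS : WClosed ends r s ω S) (h : ¬ Conn ends (wOut ends S ω) r s) :
    ¬ Conn ends (OneColourSwitch.compl (flipTouch ends S ω)) r s := by
  intro hc
  apply h
  have key : ∀ v, v ∈ {y | Conn ends (wOut ends S ω) r y ∧
      y ∈ M2 ends r s (flipTouch ends S ω)} → ∀ y,
      (openGraph ends (OneColourSwitch.compl (flipTouch ends S ω))).Adj v y →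
        y ∈ {y | Conn ends (wOut ends S ω) r y ∧ y ∈ M2 ends r s (flipTouch ends S ω)} := by
    intro v ⟨hv, hvM⟩ y hvy
    obtain ⟨_, e, he, hends⟩ := openGraph_adj.1 hvy
    have he' : flipTouch ends S ω e = false := by
      simp only [OneColourSwitch.compl, Bool.not_eq_true'] at he
      exact he
    have hyM : y ∈ M2 ends r s (flipTouch ends S ω) := mem_M2_of_closed hvM he' hends
    have hvS : v ∉ S := by
      rw [M2_flipTouch hD hM hS] at hvM; exact hvM.2
    have hyS : y ∉ S := by
      rw [M2_flipTouch hD hM hS] at hyM; exact hyM.2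
    have ht : e ∉ touches ends S := by
      rintro ⟨z, hz, w, hzw⟩
      rw [hends, Sym2.eq_iff] at hzw
      rcases hzw with ⟨rfl, _⟩ | ⟨_, rfl⟩
      · exact hvS hz
      · exact hyS hz
    have hw : wOut ends S ω e = true := by
      simp only [wOut, if_neg ht]
      rw [flipTouch_of_notMem ends ht] at he'
      rw [he']
      rfl
    exact ⟨conn_trans hv (conn_of_openAdj ⟨e, hw, hends⟩), hyM⟩
  exact (mem_of_conn_of_closed key ⟨conn_refl _ _ _, r_mem_M2 _ _ _⟩ hc).1

/-- **THEOREM ψ (pointwise)**: the switch of a closed subset `S` of the `W`-world that carries an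
`r–s` `W`-connection (`wIn`) and outside of which `r` and `s` are not `W`-connected (`wOut`)
sends a `W`-only `K`-side hub–dead-end colouring to a `Y`-only one, with `σ_pq` not larger. -/
theorem hdKYOnly_flipTouch_of_wOnly (h : HDKWOnly ends p q r s d ω)
    (hS : WClosed ends r s ω S) (hin : Conn ends (wIn ends S ω) r s)
    (hout : ¬ Conn ends (wOut ends S ω) r s) :
    HDKYOnly ends p q r s d (flipTouch ends S ω) ∧
      sigma ends (flipTouch ends S ω) p q ≤ sigma ends ω p q := by
  obtain ⟨hHD, hK, _, _⟩ := h
  have hM : d ∉ M2 ends r s ω := not_mem_M2_of_HD_K hHD hK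
  have hsep : sep2 ends p q r s ω := hHD.1
  have hD : DOne ends r s d ω := hHD.2.1
  exact ⟨⟨HD_flipTouch hHD hK hS, mem_K2_flipTouch_of_mem hD hM hS hK,
    conn_rs_flipTouch_of_wIn hin, not_conn_compl_rs_flipTouch_of_wOut hD hM hS hout⟩,
    sigma_flipTouch_le hsep hD hM hS⟩

end SwitchHD

end NoPocket

end Summit.Ventures.PercRepro2
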